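import Summits.ABC.IUTFork.LDHSlotRegimePointMixAdditive
import HarnessLib

/-!
# The CONE binder `hvol`/`hreg` WITH THE MIXED SHARE ADDED is a THEOREM, and the binder-free (U)-line squeeze it yields —
# part 2 of «HVOL-MIX-ADDITIVE» (abc-iut cell, R2 S-chain team seat abc-iut-s2-p1 gen 3; certificates `Conditional/AbcOfSGenuine*`)

Record-only PROOF file (D-0012) of the abc-iut cell; TAKES NO SIDE on [IUTchIII] Cor. 3.12 or on the (U)/(P) readings of
"−|log(Θ)|". Mochizuki, *Inter-universal Teichmüller theory IV* (RIMS manuscript Apr. 2020 = PRIMS **57** (2021)), Thm. 1.10 proof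
Steps (ii)–(viii) pp. 24–30 (Step (viii) display p. 30); Cor. 2.2 (ii) proof pp. 45–46; [IUTchIII] Cor. 3.12 p. 174.
Notation as in part 1 (`LDHSlotRegimePointMixAdditive`): `H_mix(M) := Σ_{p∈M} Σ_{V|p bad} Pr(V)·(−ord_V j(λ))·log N(V)/n_V` over the places
of `ℚ(j(λ))`, `M ⊇` the MIXED primes of `λ` (w.r.t. `ℚ(j(λ))`, `2`, `l`); `B_III(P,l)` the registered bytes.

* `PointDict.hullVolumeAtDatum_BIII_sub_slack_add_pointMixedHeight` / **`hullVolumeAtDatum_BIII_add_pointMixedHeight`** — the `∀ T` forms: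
  `Cor22.HullVolumeAtDatum P l (B_III P l + ((l+1)/24)·H_mix(M))` for `λ ∈ U_P` minimal, `7 ≤ l`, UNCONDITIONALLY;
* **`Conditional.hvolMix_holds`** — the `abc_of_S_v3`-shaped CONE statement with the corrected constant, PROVED:
  `∀ P₀ ∈ UP, ∀ l prime ≥ 5, AdmitsCore → P2 → P5 → P6 → ∀ M ⊇ mixed, HullVolumeAtDatum P₀ l (B_III + ((l+1)/24)·H_mix(M))`;
* `Conditional.hvol_offMixingLocus_holds` — v3's `hvol` conclusion PROVED at every admissible `(λ, l)` OFF the kernel-stated mixing locus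
  `Mix(λ,l) := ¬ ∃ M ⊇ mixed, ((l+1)/24)·H_mix(M) ≤ Step-(iii)/(viii) slack` (p438083 read pointwise);
* **`Conditional.squeezeMix_of_cor312At`** / `squeezeMix_of_h312` — at ONE admissible `(P,l)`: `Cor22.Cor312AtDatum P l` ALONE gives, for every
  `M ⊇` mixed, `((l+1)/24 − 1/(2l))·log q^{∤{2,l}}(λ) − ((l+1)/24)·H_mix(M) ≤ B_III(P,l) + ((l+5)/4)·log π` — [IUTchIV] Thm. 1.10 Step (viii)'s
  inequality MINUS THE MIXED SHARE, with NO hull binder (datum: abc-iut-L5-t7 `stub_thetaData`; squeeze: abc-iut-S-d2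
  `PointDict.logQAvoid_le_of_cor312AtDatum`); `squeeze_of_cor312At_of_pointSlotConstant` — `M = ∅`: the full `squeezeIII` antecedent.

READING (for the planners; numbers, nothing asserted about print). On the (U) line the typed hull of the multiradial region costs, above
print's `B_III`, at most `((l+1)/24)·H_mix` (part 1) and — by the lineage's necessity p446116 — at least `((l+1)/24)·H_mix·(1 − tail)` minus a
`3d_mod`-conductor band; abc-iut-s2-p5's filed family (`ℚ(√2)`, mixed prime `7`, window prime `l`) has `H_mix ≥ k·log 7`, unbounded. So
once `hvol`/`hreg` is refuted AS TYPED, the (U)-line statement with NO cone binder is the squeeze minus the mixed share: full strength at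
`d_mod = 1` and at every slot-constant `λ`, a Szpiro-type bound on the UNMIXED part of the conductor elsewhere. HONEST SCOPE: compositions BY
NAME; no definitions; no side taken on Cor. 3.12 / Thm. 1.10 or on any author; typed ≠ proved; refuted-as-typed ≠ refuted-in-print.
[cite: Mochizuki2012, IUTchIV Thm. 1.10 proof Steps (ii)–(viii) p. 24–30] [cite: Mochizuki2012, IUTchIV Cor. 2.2 (ii) proof p. 45–46]
[cite: Mochizuki2012, IUTchIII Cor. 3.12 p. 174] [cite: DupuyHilado2025, §3.3, §3.6, §4.7] [claim: Mochizuki2012, status: disputed]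
for every IUT quotation.
-/

noncomputable section

namespace Summit.ABC.IUTFork

open NumberField IsDedekindDomain Literature.IUT.LogVolume Literature.IUT.HodgeTheaters
open Literature.NumberTheory.DiophantineGeometry.GenEll
open scoped Classical

namespace PointDict

variable {P : NFPoint} {l : ℕ}

/-! ## 1. The `∀ T` forms at the `λ`-line -/

/-- **The `∀ T` form, SHARP: `Cor22.HullVolumeAtDatum P l (B_III − condShare − slack_π + ((l+1)/24)·H_mix(M))`** for `λ ∈ U_P` (minimally
presented), `l ≥ 7`, any finite `M ⊇` the mixed primes of `λ` — UNCONDITIONAL: no Θ-datum, no IUT object, no Szpiro hypothesis in the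
statement's antecedent. [cite: Mochizuki2012, IUTchIV Thm. 1.10 proof Steps (ii)–(viii) p. 24–30] [cite: DupuyHilado2025, §3.3, §3.6, §4.7]
[claim: Mochizuki2012, status: disputed] -/
theorem hullVolumeAtDatum_BIII_sub_slack_add_pointMixedHeight (hP : P ∈ UP) (h7 : 7 ≤ l) (M : Finset ℕ)
    (hM : ∀ p : ℕ, p.Prime →
      (¬ ∀ V W : HeightOneSpectrum (𝓞 ↥(IntermediateField.adjoin ℚ ({Cor22.jInv P.x} : Set P.F))),
        V ∈ placesOver _ p → W ∈ placesOver _ p →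
        (if ord _ V (Cor22.jMod P) < 0 ∧ ((2 : ℕ) : 𝓞 _) ∉ V.asIdeal ∧ ((l : ℕ) : 𝓞 _) ∉ V.asIdeal
          then ((-ord _ V (Cor22.jMod P) : ℤ) : ℝ) * logNorm _ V / (localDegree _ V : ℝ) else 0) =
        (if ord _ W (Cor22.jMod P) < 0 ∧ ((2 : ℕ) : 𝓞 _) ∉ W.asIdeal ∧ ((l : ℕ) : 𝓞 _) ∉ W.asIdeal
          then ((-ord _ W (Cor22.jMod P) : ℤ) : ℝ) * logNorm _ W / (localDegree _ W : ℝ) else 0)) → p ∈ M) :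
    Cor22.HullVolumeAtDatum P l (((l : ℝ) + 1) / 4 * ((1 + 12 * (Cor22.dmod P : ℝ) / l)
      * (P.logDiff + Cor22.logCondAvoid P {2, l}) + 2 * Real.log l + 52
        + 20 / 3 * Real.log (((2 ^ 12 * 3 ^ 3 * 5 * Cor22.dmod P : ℕ) : ℝ) * (l : ℝ))
          * (Nat.primeCounting (2 ^ 12 * 3 ^ 3 * 5 * Cor22.dmod P * l) : ℝ))
      - ((l : ℝ) + 1) / 4 * (4 * ((Cor22.dmod P : ℝ) - 1) / l * (P.logDiff + Cor22.logCondAvoid P {2, l})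
          + 20 / 3 * Real.log (((2 ^ 12 * 3 ^ 3 * 5 * Cor22.dmod P : ℕ) : ℝ) * l)
            * max 0 (((Nat.primeCounting (2 ^ 12 * 3 ^ 3 * 5 * Cor22.dmod P * l) : ℝ)
              - (2 * (Cor22.dmod P : ℝ) * (P.logDiff + Cor22.logCondAvoid P {2, l}) + Real.log (2 * 3 * 5 * (l : ℝ)))
                / Real.log 2)))
      + ((l : ℝ) + 1) / 24 *
        ∑ p ∈ M, ∑ V : placesOver ↥(IntermediateField.adjoin ℚ ({Cor22.jInv P.x} : Set P.F)) p,
          (if ord _ V.1 (Cor22.jMod P) < 0 ∧ ((2 : ℕ) : 𝓞 _) ∉ V.1.asIdeal ∧ ((l : ℕ) : 𝓞 _) ∉ V.1.asIdeal then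
            weight _ V.1 * (((-ord _ V.1 (Cor22.jMod P) : ℤ) : ℝ) * logNorm _ V.1 / (localDegree _ V.1 : ℝ))
           else 0)) :=
  fun T => hullEstimateOf_BIII_sub_slack_add_pointMixedHeight T hP h7 M hM

/-- **The `∀ T` form, CLEAN: `Cor22.HullVolumeAtDatum P l (B_III P l + ((l+1)/24)·H_mix(M))`** — the conclusion of the CONE binder
`hvol`/`hreg` at `(P, l)` WITH THE MIXED SHARE ADDED to print's constant, for `λ ∈ U_P` (minimally presented), `l ≥ 7` and any finite
`M ⊇` the mixed primes of `λ`; UNCONDITIONAL. This is (ii′-U) at every `d_mod` with the honest constant: by the lineage's necessity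
(p446116) the added term cannot be lowered below `((l+1)/24)·H_mix·(1 − tail)` minus a `3d_mod`-conductor band.
[cite: Mochizuki2012, IUTchIV Thm. 1.10 proof Steps (ii)–(viii) p. 24–30] [cite: DupuyHilado2025, §3.3, §3.6, §4.7] [claim: Mochizuki2012, status: disputed] -/
theorem hullVolumeAtDatum_BIII_add_pointMixedHeight (hP : P ∈ UP) (h7 : 7 ≤ l) (M : Finset ℕ)
    (hM : ∀ p : ℕ, p.Prime →
      (¬ ∀ V W : HeightOneSpectrum (𝓞 ↥(IntermediateField.adjoin ℚ ({Cor22.jInv P.x} : Set P.F))),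
        V ∈ placesOver _ p → W ∈ placesOver _ p →
        (if ord _ V (Cor22.jMod P) < 0 ∧ ((2 : ℕ) : 𝓞 _) ∉ V.asIdeal ∧ ((l : ℕ) : 𝓞 _) ∉ V.asIdeal
          then ((-ord _ V (Cor22.jMod P) : ℤ) : ℝ) * logNorm _ V / (localDegree _ V : ℝ) else 0) =
        (if ord _ W (Cor22.jMod P) < 0 ∧ ((2 : ℕ) : 𝓞 _) ∉ W.asIdeal ∧ ((l : ℕ) : 𝓞 _) ∉ W.asIdeal
          then ((-ord _ W (Cor22.jMod P) : ℤ) : ℝ) * logNorm _ W / (localDegree _ W : ℝ) else 0)) → p ∈ M) :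
    Cor22.HullVolumeAtDatum P l (((l : ℝ) + 1) / 4 * ((1 + 12 * (Cor22.dmod P : ℝ) / l)
      * (P.logDiff + Cor22.logCondAvoid P {2, l}) + 2 * Real.log l + 52
        + 20 / 3 * Real.log (((2 ^ 12 * 3 ^ 3 * 5 * Cor22.dmod P : ℕ) : ℝ) * (l : ℝ))
          * (Nat.primeCounting (2 ^ 12 * 3 ^ 3 * 5 * Cor22.dmod P * l) : ℝ))
      + ((l : ℝ) + 1) / 24 *
        ∑ p ∈ M, ∑ V : placesOver ↥(IntermediateField.adjoin ℚ ({Cor22.jInv P.x} : Set P.F)) p,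
          (if ord _ V.1 (Cor22.jMod P) < 0 ∧ ((2 : ℕ) : 𝓞 _) ∉ V.1.asIdeal ∧ ((l : ℕ) : 𝓞 _) ∉ V.1.asIdeal then
            weight _ V.1 * (((-ord _ V.1 (Cor22.jMod P) : ℤ) : ℝ) * logNorm _ V.1 / (localDegree _ V.1 : ℝ))
           else 0)) :=
  fun T => hullEstimateOf_BIII_add_pointMixedHeight T hP h7 M hM

end PointDict

namespace Conditional

/-! ## 2. Binder-shaped forms: the corrected CONE statement PROVED, and the binder-free squeeze minus the mixed share -/

/-- **The `abc_of_S_v3`-shaped CONE statement WITH THE MIXED SHARE ADDED — PROVED.** For every `λ ∈ U_X` (minimally presented), prime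
`l ≥ 5`, «admits an `F`-core», (P2), (P5), (P6) (so `7 ≤ l`, abc-iut-c312-8's `seven_le_of_condP6`) and every finite `M ⊇` the mixed primes of
`λ`: `Cor22.HullVolumeAtDatum P₀ l (B_III(P₀,l) + ((l+1)/24)·H_mix(M))`. Compare v3's binder `hvol` (the same with `H_mix` absent): the two
agree at every `λ` with no mixed prime (`M = ∅`, e.g. `d_mod = 1`). Nothing here asserts `hvol`; no side taken.
[cite: Mochizuki2012, IUTchIV Thm. 1.10 proof Steps (ii)–(viii) p. 24–30] [cite: Mochizuki2012, IUTchIV Cor. 2.2 (ii) proof p. 46]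
[claim: Mochizuki2012, status: disputed] -/
theorem hvolMix_holds :
    ∀ P₀ : NFPoint, P₀ ∈ UP → ∀ l : ℕ, l.Prime → 5 ≤ l →
      Cor22.AdmitsCore P₀ → Cor22.CondP2 P₀ l → Cor22.CondP5 P₀ l → Cor22.CondP6 P₀ l →
      ∀ M : Finset ℕ,
        (∀ p : ℕ, p.Prime →
          (¬ ∀ V W : HeightOneSpectrum (𝓞 ↥(IntermediateField.adjoin ℚ ({Cor22.jInv P₀.x} : Set P₀.F))),
            V ∈ placesOver _ p → W ∈ placesOver _ p →
            (if ord _ V (Cor22.jMod P₀) < 0 ∧ ((2 : ℕ) : 𝓞 _) ∉ V.asIdeal ∧ ((l : ℕ) : 𝓞 _) ∉ V.asIdeal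
              then ((-ord _ V (Cor22.jMod P₀) : ℤ) : ℝ) * logNorm _ V / (localDegree _ V : ℝ) else 0) =
            (if ord _ W (Cor22.jMod P₀) < 0 ∧ ((2 : ℕ) : 𝓞 _) ∉ W.asIdeal ∧ ((l : ℕ) : 𝓞 _) ∉ W.asIdeal
              then ((-ord _ W (Cor22.jMod P₀) : ℤ) : ℝ) * logNorm _ W / (localDegree _ W : ℝ) else 0)) → p ∈ M) →
        Cor22.HullVolumeAtDatum P₀ l (((l : ℝ) + 1) / 4 *
          ((1 + 12 * (Cor22.dmod P₀ : ℝ) / l) * (P₀.logDiff + Cor22.logCondAvoid P₀ {2, l})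
            + 2 * Real.log l + 52
            + 20 / 3 * Real.log (((2 ^ 12 * 3 ^ 3 * 5 * Cor22.dmod P₀ : ℕ) : ℝ) * (l : ℝ))
              * (Nat.primeCounting (2 ^ 12 * 3 ^ 3 * 5 * Cor22.dmod P₀ * l) : ℝ))
          + ((l : ℝ) + 1) / 24 *
            ∑ p ∈ M, ∑ V : placesOver ↥(IntermediateField.adjoin ℚ ({Cor22.jInv P₀.x} : Set P₀.F)) p,
              (if ord _ V.1 (Cor22.jMod P₀) < 0 ∧ ((2 : ℕ) : 𝓞 _) ∉ V.1.asIdeal ∧ ((l : ℕ) : 𝓞 _) ∉ V.1.asIdeal then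
                weight _ V.1 * (((-ord _ V.1 (Cor22.jMod P₀) : ℤ) : ℝ) * logNorm _ V.1 / (localDegree _ V.1 : ℝ))
               else 0)) := by
  intro P hP l hl h5 _ _ _ h6 M hM
  exact PointDict.hullVolumeAtDatum_BIII_add_pointMixedHeight hP
    (Summit.ABC.ABC.Theorems.ThetaPartII.seven_le_of_condP6 hP hl h5 h6) M hM

/-- **v3's `hvol` / v4's `hreg` conclusion PROVED OFF THE KERNEL-STATED MIXING LOCUS.** For every admissible `(λ, l)` (`λ ∈ U_X` minimal,
prime `l ≥ 5`, «admits an `F`-core», (P2), (P5), (P6)) at which SOME finite `M ⊇` the mixed primes of `λ` satisfies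
`((l+1)/24)·H_mix(M) ≤ (l+1)/4·{(4(d_mod−1)/l)·(lD+lC) + (20/3)·log(d*l)·max(0, π(d*l) − (2d_mod(lD+lC)+log(30l))/log 2)}` (the complement of
this condition is a kernel-stated «mixing locus» `Mix(λ,l)`): `Cor22.HullVolumeAtDatum P₀ l (B_III P₀ l)` — the lineage's p438083 read
pointwise; i.e. a binder «`hvol`/`hreg` demanded only ON `Mix`» leaves nothing to assume OFF `Mix`. Nothing asserted on `Mix`; no side taken.
[cite: Mochizuki2012, IUTchIV Thm. 1.10 proof Steps (ii)–(viii) p. 24–30] [claim: Mochizuki2012, status: disputed] -/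
theorem hvol_offMixingLocus_holds :
    ∀ P₀ : NFPoint, P₀ ∈ UP → ∀ l : ℕ, l.Prime → 5 ≤ l →
      Cor22.AdmitsCore P₀ → Cor22.CondP2 P₀ l → Cor22.CondP5 P₀ l → Cor22.CondP6 P₀ l →
      (∃ M : Finset ℕ,
        (∀ p : ℕ, p.Prime →
          (¬ ∀ V W : HeightOneSpectrum (𝓞 ↥(IntermediateField.adjoin ℚ ({Cor22.jInv P₀.x} : Set P₀.F))),
            V ∈ placesOver _ p → W ∈ placesOver _ p →
            (if ord _ V (Cor22.jMod P₀) < 0 ∧ ((2 : ℕ) : 𝓞 _) ∉ V.asIdeal ∧ ((l : ℕ) : 𝓞 _) ∉ V.asIdeal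
              then ((-ord _ V (Cor22.jMod P₀) : ℤ) : ℝ) * logNorm _ V / (localDegree _ V : ℝ) else 0) =
            (if ord _ W (Cor22.jMod P₀) < 0 ∧ ((2 : ℕ) : 𝓞 _) ∉ W.asIdeal ∧ ((l : ℕ) : 𝓞 _) ∉ W.asIdeal
              then ((-ord _ W (Cor22.jMod P₀) : ℤ) : ℝ) * logNorm _ W / (localDegree _ W : ℝ) else 0)) → p ∈ M) ∧
        ((l : ℝ) + 1) / 24 *
            ∑ p ∈ M, ∑ V : placesOver ↥(IntermediateField.adjoin ℚ ({Cor22.jInv P₀.x} : Set P₀.F)) p,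
              (if ord _ V.1 (Cor22.jMod P₀) < 0 ∧ ((2 : ℕ) : 𝓞 _) ∉ V.1.asIdeal ∧ ((l : ℕ) : 𝓞 _) ∉ V.1.asIdeal then
                weight _ V.1 * (((-ord _ V.1 (Cor22.jMod P₀) : ℤ) : ℝ) * logNorm _ V.1 / (localDegree _ V.1 : ℝ))
               else 0) ≤
          ((l : ℝ) + 1) / 4 * (4 * ((Cor22.dmod P₀ : ℝ) - 1) / l * (P₀.logDiff + Cor22.logCondAvoid P₀ {2, l})
            + 20 / 3 * Real.log (((2 ^ 12 * 3 ^ 3 * 5 * Cor22.dmod P₀ : ℕ) : ℝ) * l)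
              * max 0 (((Nat.primeCounting (2 ^ 12 * 3 ^ 3 * 5 * Cor22.dmod P₀ * l) : ℝ)
                - (2 * (Cor22.dmod P₀ : ℝ) * (P₀.logDiff + Cor22.logCondAvoid P₀ {2, l}) + Real.log (2 * 3 * 5 * (l : ℝ)))
                  / Real.log 2)))) →
        Cor22.HullVolumeAtDatum P₀ l (((l : ℝ) + 1) / 4 *
          ((1 + 12 * (Cor22.dmod P₀ : ℝ) / l) * (P₀.logDiff + Cor22.logCondAvoid P₀ {2, l})
            + 2 * Real.log l + 52
            + 20 / 3 * Real.log (((2 ^ 12 * 3 ^ 3 * 5 * Cor22.dmod P₀ : ℕ) : ℝ) * (l : ℝ))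
              * (Nat.primeCounting (2 ^ 12 * 3 ^ 3 * 5 * Cor22.dmod P₀ * l) : ℝ))) := by
  intro P hP l hl h5 _ _ _ h6 hOff
  obtain ⟨M, hM, h⟩ := hOff
  exact PointDict.hullVolumeAtDatum_BIII_of_pointMixedHeight_le_szpiroMax hP
    (Summit.ABC.ABC.Theorems.ThetaPartII.seven_le_of_condP6 hP hl h5 h6) M hM h

/-- **THE BINDER-FREE SQUEEZE ON THE (U) LINE: [IUTchIV] Thm. 1.10 Step (viii)'s inequality MINUS THE MIXED SHARE, from Cor. 3.12 at the
point ALONE.** At ONE admissible `(λ, l)` (`λ ∈ U_X` minimal, prime `l ≥ 5`, «admits an `F`-core», (P2), (P5), (P6)): IF [IUTchIII] Cor. 3.12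
holds at the genuine Θ-volume data of `(P, l)` (`Cor22.Cor312AtDatum P l`, HYPOTHESIS — disputed), THEN for every finite `M ⊇` the mixed primes of `λ`:
`((l+1)/24 − 1/(2l))·log q^{∤{2,l}}(λ) − ((l+1)/24)·H_mix(M) ≤ B_III(P,l) + ((l+5)/4)·log π` — NO hull binder (`hvol`/`hreg`/`hres`/`hSz`):
the computable half is `hvolMix_holds`, the datum is abc-iut-L5-t7's `stub_thetaData`, the squeeze is abc-iut-S-d2's
`PointDict.logQAvoid_le_of_cor312AtDatum`. At `M = ∅` (no mixed prime, e.g. `d_mod = 1`) this is the full squeeze `squeezeIII` consumed by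
abc-iut-c312-8's `ThetaPartII_of_squeezeIII`; at `d_mod ≥ 2` it bounds the UNMIXED part of the conductor. CONDITIONAL on Cor. 3.12 only;
nothing asserted about it; no side taken. [cite: Mochizuki2012, IUTchIV Thm. 1.10 Step (viii) p. 30] [cite: Mochizuki2012, IUTchIII Cor. 3.12 p. 174]
[claim: Mochizuki2012, status: disputed] -/
theorem squeezeMix_of_cor312At {P : NFPoint} (hP : P ∈ UP) {l : ℕ} (hl : l.Prime) (h5 : 5 ≤ l)
    (hcore : Cor22.AdmitsCore P) (hP2 : Cor22.CondP2 P l) (hP5 : Cor22.CondP5 P l) (h6 : Cor22.CondP6 P l)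
    (h312 : Cor22.Cor312AtDatum P l) (M : Finset ℕ)
    (hM : ∀ p : ℕ, p.Prime →
      (¬ ∀ V W : HeightOneSpectrum (𝓞 ↥(IntermediateField.adjoin ℚ ({Cor22.jInv P.x} : Set P.F))),
        V ∈ placesOver _ p → W ∈ placesOver _ p →
        (if ord _ V (Cor22.jMod P) < 0 ∧ ((2 : ℕ) : 𝓞 _) ∉ V.asIdeal ∧ ((l : ℕ) : 𝓞 _) ∉ V.asIdeal
          then ((-ord _ V (Cor22.jMod P) : ℤ) : ℝ) * logNorm _ V / (localDegree _ V : ℝ) else 0) =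
        (if ord _ W (Cor22.jMod P) < 0 ∧ ((2 : ℕ) : 𝓞 _) ∉ W.asIdeal ∧ ((l : ℕ) : 𝓞 _) ∉ W.asIdeal
          then ((-ord _ W (Cor22.jMod P) : ℤ) : ℝ) * logNorm _ W / (localDegree _ W : ℝ) else 0)) → p ∈ M) :
    (((l : ℝ) + 1) / 24 - 1 / (2 * l)) * Cor22.logQAvoid P {2, l}
      - ((l : ℝ) + 1) / 24 *
        ∑ p ∈ M, ∑ V : placesOver ↥(IntermediateField.adjoin ℚ ({Cor22.jInv P.x} : Set P.F)) p,
          (if ord _ V.1 (Cor22.jMod P) < 0 ∧ ((2 : ℕ) : 𝓞 _) ∉ V.1.asIdeal ∧ ((l : ℕ) : 𝓞 _) ∉ V.1.asIdeal then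
            weight _ V.1 * (((-ord _ V.1 (Cor22.jMod P) : ℤ) : ℝ) * logNorm _ V.1 / (localDegree _ V.1 : ℝ))
           else 0) ≤
      ((l : ℝ) + 1) / 4 *
          ((1 + 12 * (Cor22.dmod P : ℝ) / l) * (P.logDiff + Cor22.logCondAvoid P {2, l})
            + 2 * Real.log l + 52
            + 20 / 3 * Real.log (((2 ^ 12 * 3 ^ 3 * 5 * Cor22.dmod P : ℕ) : ℝ) * (l : ℝ))
              * (Nat.primeCounting (2 ^ 12 * 3 ^ 3 * 5 * Cor22.dmod P * l) : ℝ))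
        + ThetaVolumeInput.archLogTheta l := by
  have h7 : 7 ≤ l := Summit.ABC.ABC.Theorems.ThetaPartII.seven_le_of_condP6 hP hl h5 h6
  obtain ⟨T⟩ := Summit.ABC.ABC.Theorems.ThetaPartII.stub_thetaData P hP l hl h5 hcore hP2 hP5 h6
  have hsq := PointDict.logQAvoid_le_of_cor312AtDatum h312
    (PointDict.hullVolumeAtDatum_BIII_add_pointMixedHeight hP h7 M hM) T hP.1
  linarith

/-- **The global form from abc-iut-c312-8's `stub_cor312` binder `h312` VERBATIM**: [IUTchIII] Cor. 3.12 (reading (U)) at the Θ-volume data of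
every admissible `(P, l)` implies, at every admissible `(P, l)` and for every finite `M ⊇` the mixed primes of `λ`, the squeeze minus the mixed
share — with NO second (U)-stub. Usage next to `ThetaPartII.ABC_of_cor312_of_hullRegime h312 hreg`: the part of its conclusion that survives
WITHOUT `hreg`. CONDITIONAL; nothing asserted about `h312`; no side taken. [cite: Mochizuki2012, IUTchIV Cor. 2.2 (ii) proof p. 45–46]
[cite: Mochizuki2012, IUTchIII Cor. 3.12 p. 174] [claim: Mochizuki2012, status: disputed] -/
theorem squeezeMix_of_h312
    (h312 : ∀ P : NFPoint, P ∈ UP → ∀ l : ℕ, l.Prime → 5 ≤ l →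
      Cor22.AdmitsCore P → Cor22.CondP2 P l → Cor22.CondP5 P l → Cor22.CondP6 P l →
        Cor22.Cor312AtDatum P l) :
    ∀ P : NFPoint, P ∈ UP → ∀ l : ℕ, l.Prime → 5 ≤ l →
      Cor22.AdmitsCore P → Cor22.CondP2 P l → Cor22.CondP5 P l → Cor22.CondP6 P l →
      ∀ M : Finset ℕ,
        (∀ p : ℕ, p.Prime →
          (¬ ∀ V W : HeightOneSpectrum (𝓞 ↥(IntermediateField.adjoin ℚ ({Cor22.jInv P.x} : Set P.F))),
            V ∈ placesOver _ p → W ∈ placesOver _ p →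
            (if ord _ V (Cor22.jMod P) < 0 ∧ ((2 : ℕ) : 𝓞 _) ∉ V.asIdeal ∧ ((l : ℕ) : 𝓞 _) ∉ V.asIdeal
              then ((-ord _ V (Cor22.jMod P) : ℤ) : ℝ) * logNorm _ V / (localDegree _ V : ℝ) else 0) =
            (if ord _ W (Cor22.jMod P) < 0 ∧ ((2 : ℕ) : 𝓞 _) ∉ W.asIdeal ∧ ((l : ℕ) : 𝓞 _) ∉ W.asIdeal
              then ((-ord _ W (Cor22.jMod P) : ℤ) : ℝ) * logNorm _ W / (localDegree _ W : ℝ) else 0)) → p ∈ M) →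
        (((l : ℝ) + 1) / 24 - 1 / (2 * l)) * Cor22.logQAvoid P {2, l}
          - ((l : ℝ) + 1) / 24 *
            ∑ p ∈ M, ∑ V : placesOver ↥(IntermediateField.adjoin ℚ ({Cor22.jInv P.x} : Set P.F)) p,
              (if ord _ V.1 (Cor22.jMod P) < 0 ∧ ((2 : ℕ) : 𝓞 _) ∉ V.1.asIdeal ∧ ((l : ℕ) : 𝓞 _) ∉ V.1.asIdeal then
                weight _ V.1 * (((-ord _ V.1 (Cor22.jMod P) : ℤ) : ℝ) * logNorm _ V.1 / (localDegree _ V.1 : ℝ))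
               else 0) ≤
          ((l : ℝ) + 1) / 4 *
              ((1 + 12 * (Cor22.dmod P : ℝ) / l) * (P.logDiff + Cor22.logCondAvoid P {2, l})
                + 2 * Real.log l + 52
                + 20 / 3 * Real.log (((2 ^ 12 * 3 ^ 3 * 5 * Cor22.dmod P : ℕ) : ℝ) * (l : ℝ))
                  * (Nat.primeCounting (2 ^ 12 * 3 ^ 3 * 5 * Cor22.dmod P * l) : ℝ))
            + ThetaVolumeInput.archLogTheta l :=
  fun P hP l hl h5 hcore hP2 hP5 h6 M hM =>
    squeezeMix_of_cor312At hP hl h5 hcore hP2 hP5 h6 (h312 P hP l hl h5 hcore hP2 hP5 h6) M hM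

/-- **The full squeeze at a `λ` with NO mixed prime, from Cor. 3.12 at the point ALONE** (the case `M = ∅` of `squeezeMix_of_cor312At`:
`h♭` constant over every prime — e.g. `d_mod = 1`, or every bad prime of `j(λ)` inert/totally ramified in `ℚ(j(λ))`): at such an admissible
`(λ, l)`, `Cor22.Cor312AtDatum P l` implies `((l+1)/24 − 1/(2l))·log q^{∤{2,l}}(λ) ≤ B_III(P,l) + ((l+5)/4)·log π` — the `squeezeIII`
antecedent of abc-iut-c312-8's `ThetaPartII_of_squeezeIII` at that point, no hull binder. CONDITIONAL on Cor. 3.12 only; no side taken.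
[cite: Mochizuki2012, IUTchIV Thm. 1.10 Step (viii) p. 30] [claim: Mochizuki2012, status: disputed] -/
theorem squeeze_of_cor312At_of_pointSlotConstant {P : NFPoint} (hP : P ∈ UP) {l : ℕ} (hl : l.Prime) (h5 : 5 ≤ l)
    (hcore : Cor22.AdmitsCore P) (hP2 : Cor22.CondP2 P l) (hP5 : Cor22.CondP5 P l) (h6 : Cor22.CondP6 P l)
    (h312 : Cor22.Cor312AtDatum P l)
    (hconst : ∀ p : ℕ, p.Prime →
      ∀ V W : HeightOneSpectrum (𝓞 ↥(IntermediateField.adjoin ℚ ({Cor22.jInv P.x} : Set P.F))),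
        V ∈ placesOver _ p → W ∈ placesOver _ p →
        (if ord _ V (Cor22.jMod P) < 0 ∧ ((2 : ℕ) : 𝓞 _) ∉ V.asIdeal ∧ ((l : ℕ) : 𝓞 _) ∉ V.asIdeal
          then ((-ord _ V (Cor22.jMod P) : ℤ) : ℝ) * logNorm _ V / (localDegree _ V : ℝ) else 0) =
        (if ord _ W (Cor22.jMod P) < 0 ∧ ((2 : ℕ) : 𝓞 _) ∉ W.asIdeal ∧ ((l : ℕ) : 𝓞 _) ∉ W.asIdeal
          then ((-ord _ W (Cor22.jMod P) : ℤ) : ℝ) * logNorm _ W / (localDegree _ W : ℝ) else 0)) :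
    (((l : ℝ) + 1) / 24 - 1 / (2 * l)) * Cor22.logQAvoid P {2, l} ≤
      ((l : ℝ) + 1) / 4 *
          ((1 + 12 * (Cor22.dmod P : ℝ) / l) * (P.logDiff + Cor22.logCondAvoid P {2, l})
            + 2 * Real.log l + 52
            + 20 / 3 * Real.log (((2 ^ 12 * 3 ^ 3 * 5 * Cor22.dmod P : ℕ) : ℝ) * (l : ℝ))
              * (Nat.primeCounting (2 ^ 12 * 3 ^ 3 * 5 * Cor22.dmod P * l) : ℝ))
        + ThetaVolumeInput.archLogTheta l := by
  have h := squeezeMix_of_cor312At hP hl h5 hcore hP2 hP5 h6 h312 ∅ (fun p hp hnot => (hnot (hconst p hp)).elim)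
  simpa using h

end Conditional

end Summit.ABC.IUTFork

end
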